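import Literature.Probability.RandomPlanarGeometry.LoewnerRegularCurves
import HarnessLib

/-!
# Line `marked-point-revisit` — stub `stub_shadowGlue` of the crux `SimpleSubseqLimits`
(stmt-CriticalPhenomena-4982; route decl
`Summit.CriticalPhenomena.SAWScalingLimit.Theses.SAWLoopFugacityFlow.SimpleSubseqLimits`;
registered skeleton
`Summits/CriticalPhenomena/SAWScalingLimit/Cruxes/SimpleSubseqLimits/Lines/marked_point_revisit.lean`,
reshape v2)

The deterministic GLUE of the line, one curve class at a time: SHAPE (the range of the class is a
simple arc with the same endpoints) + ORDER (no representative `(1/(k+1), 1/(k+1))`-shadows its own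
past, for every `k`) ⇒ the class is SIMPLE.

* `Shadows`, `shadowEvent` — VERBATIM the registered skeleton's vocabulary (sub-namespace
  `…MarkedPointRevisit.ShadowGlue`; definitionally equal to the skeleton's copies).
* `simple_of_arc_range_of_strictGrowth` — the argmax lemma: arc range + strict range growth on
  every nondegenerate parameter interval ⇒ injective.
* `strictGrowth_of_not_shadows` — a light curve (no interval of constancy) none of whose
  `(1/(k+1), 1/(k+1))`-shadowings occurs has strictly growing range.
* `mem_simple_of_arc_of_notMem_shadowEvent` — light representative (`Curve.exists_light_of_ne`)
  + the two lemmas.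
* `stub_shadowGlue` — the registered stub, by name and signature.

The three proofs are vendored from the crux workfile
`Cruxes/SimpleSubseqLimits/Lines/past-shadowing-costs-halves.lean`
(planner-cruxplan-stmt-CriticalPhenomena-4982-past-shadowing-costs-0; argmax lemma by crux ideator 3),
which is not importable from `Theorems/`.
-/

noncomputable section

open MeasureTheory Filter Topology Set Metric Function
open Literature.Probability.RandomPlanarGeometry
open scoped ENNReal NNReal BoundedContinuousFunction unitInterval

namespace Summit.CriticalPhenomena.SAWScalingLimit.Theorems.SimpleSubseqLimits.MarkedPointRevisit.ShadowGlue

/-! ## Vocabulary (verbatim the registered skeleton) -/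

/-- `γ` **`(η, ρ)`-shadows its own past**: after some time `s₀` it travels through a stretch
`[t, t']` of displacement `≥ η` every point of which was already visited before `s₀` at a point at
distance `≥ ρ` from `γ s₀` ("travelling along the own past outside the `ρ`-ball at the tip").
[folklore] -/
def Shadows (γ : Curve ℂ) (η ρ : ℝ) : Prop :=
  ∃ s₀ t t' : I, s₀ ≤ t ∧ t ≤ t' ∧ η ≤ dist (γ t) (γ t') ∧
    ∀ u : I, t ≤ u → u ≤ t' → γ u ∈ γ '' {v : I | v ≤ s₀ ∧ ρ ≤ dist (γ v) (γ s₀)}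

/-- The event "some representative `(η, ρ)`-shadows its own past" on curve classes. [folklore] -/
def shadowEvent (η ρ : ℝ) : Set (CurveClass ℂ) :=
  {c | ∃ γ : Curve ℂ, CurveClass.mk γ = c ∧ Shadows γ η ρ}

/-! ## The argmax lemma -/

/-- **Argmax lemma** (ideator 3's `simple_of_arc_range_of_strictGrowth`): if the range of `γ` is a
simple arc `e` with the same endpoints and the range STRICTLY GROWS on every nondegenerate
parameter interval, then `γ` is injective, so its class is simple (`f = e⁻¹ ∘ γ`; a dip of `f`
below an earlier maximum contradicts growth via the intermediate value theorem).
(vendored from the crux workfile `Cruxes/SimpleSubseqLimits/Lines/past-shadowing-costs-halves.lean`,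
planner-cruxplan-stmt-CriticalPhenomena-4982-past-shadowing-costs-0; argmax lemma by crux ideator 3)
[folklore] -/
theorem simple_of_arc_range_of_strictGrowth (γ : Curve ℂ) (e : C(unitInterval, ℂ))
    (he : Function.Injective e) (hrange : Set.range e = γ.range)
    (h0 : e 0 = γ 0) (h1 : e 1 = γ 1)
    (hgrow : ∀ s t : unitInterval, s < t → ¬ (γ '' Set.Icc s t ⊆ γ '' Set.Icc 0 s)) :
    CurveClass.mk γ ∈ CurveClass.simple := by
  classical
  have _h1 := h1
  have hmem : ∀ t, γ t ∈ Set.range e := fun t => by rw [hrange]; exact ⟨t, rfl⟩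
  let E : unitInterval ≃ Set.range e := Equiv.ofInjective e he
  have hEcont : Continuous E := continuous_induced_rng.2 e.continuous
  have hEsymm : Continuous E.symm := Continuous.continuous_symm_of_equiv_compact_to_t2 hEcont
  let f : unitInterval → unitInterval := fun t => E.symm ⟨γ t, hmem t⟩
  have hγc : Continuous fun t : unitInterval => (⟨γ t, hmem t⟩ : Set.range e) :=
    continuous_induced_rng.2 γ.continuous
  have hf : Continuous f := hEsymm.comp hγc
  have hef : ∀ t, e (f t) = γ t := by
    intro t
    have h : ((E (f t) : Set.range e) : ℂ) = γ t := by
      show ((E (E.symm ⟨γ t, hmem t⟩) : Set.range e) : ℂ) = γ t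
      rw [Equiv.apply_symm_apply]
    rw [← h]
    rfl
  have hf0 : f 0 = 0 := he ((hef 0).trans h0.symm)
  -- real-valued copy of `f` and its extension to `ℝ` for the intermediate value theorem
  let F : unitInterval → ℝ := fun t => (f t : ℝ)
  have hF : Continuous F := continuous_subtype_val.comp hf
  let FR : ℝ → ℝ := F ∘ Set.projIcc (0 : ℝ) 1 zero_le_one
  have hFR : Continuous FR := hF.comp continuous_projIcc
  -- the key step: a point `ts < t₂` dominating `f` on `[0, t₂]` contradicts strict growth
  have key : ∀ ts t₂ : unitInterval, ts < t₂ → (∀ t : unitInterval, t ≤ t₂ → F t ≤ F ts) →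
      False := by
    intro ts t₂ hts hdom
    apply hgrow ts t₂ hts
    rintro _ ⟨t, ⟨hst, htt⟩, rfl⟩
    have hle : F t ≤ F ts := hdom t htt
    have hge : F 0 ≤ F t := by
      show ((f 0 : unitInterval) : ℝ) ≤ (f t : ℝ)
      rw [hf0]; exact (f t).2.1
    -- IVT for `FR` on `[0, ts]`
    have hts0 : (0 : ℝ) ≤ (ts : ℝ) := ts.2.1
    have hIVT := intermediate_value_Icc hts0 hFR.continuousOn
    have hFR0 : FR 0 = F 0 := by
      show F (Set.projIcc 0 1 zero_le_one 0) = F 0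
      rw [Set.projIcc_left]; rfl
    have hFRts : FR ts = F ts := by
      show F (Set.projIcc 0 1 zero_le_one (ts : ℝ)) = F ts
      rw [Set.projIcc_val]
    have hmemI : F t ∈ Set.Icc (FR 0) (FR ts) := by
      rw [hFR0, hFRts]; exact ⟨hge, hle⟩
    obtain ⟨x, hx, hxval⟩ := hIVT hmemI
    have hx01 : x ∈ Set.Icc (0 : ℝ) 1 := ⟨hx.1, hx.2.trans ts.2.2⟩
    set s : unitInterval := Set.projIcc 0 1 zero_le_one x with hs
    have hsx : (s : ℝ) = x := by rw [hs, Set.projIcc_of_mem _ hx01]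
    have hfs : f s = f t := by
      apply Subtype.ext
      show F s = F t
      have : FR x = F s := rfl
      rw [← this, hxval]
    refine ⟨s, ⟨bot_le, ?_⟩, ?_⟩
    · show (s : ℝ) ≤ (ts : ℝ)
      rw [hsx]; exact hx.2
    · rw [← hef, hfs, hef]
  have hmono : StrictMono f := by
    intro t₁ t₂ hlt
    by_contra hnot
    have hle : f t₂ ≤ f t₁ := not_lt.1 hnot
    have hS : IsClosed {t : unitInterval | (t : ℝ) ≤ (t₂ : ℝ)} :=
      isClosed_le continuous_subtype_val continuous_const
    obtain ⟨tm, htm, hmax⟩ :=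
      hS.isCompact.exists_isMaxOn ⟨t₂, show ((t₂ : unitInterval) : ℝ) ≤ t₂ from le_rfl⟩
        hF.continuousOn
    have htm' : tm ≤ t₂ := htm
    by_cases hlt2 : tm < t₂
    · exact key tm t₂ hlt2 (fun t ht => hmax (show ((t : unitInterval) : ℝ) ≤ t₂ from ht))
    · have htm2 : tm = t₂ := le_antisymm htm' (not_lt.1 hlt2)
      refine key t₁ t₂ hlt (fun t ht => ?_)
      have h1' : F t ≤ F tm := hmax (show ((t : unitInterval) : ℝ) ≤ t₂ from ht)
      have h2' : F t₂ ≤ F t₁ := by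
        show ((f t₂ : unitInterval) : ℝ) ≤ (f t₁ : ℝ)
        exact_mod_cast hle
      calc F t ≤ F tm := h1'
        _ = F t₂ := by rw [htm2]
        _ ≤ F t₁ := h2'
  have hinj : Function.Injective γ := by
    intro a b hab
    apply hmono.injective
    apply he
    rw [hef, hef]; exact hab
  exact CurveClass.mk_mem_simple hinj

/-! ## No shadowing forces strict range growth -/

/-- **No shadowing ⇒ strict range growth** for a LIGHT curve (no interval of constancy): if
`γ '' [s, t] ⊆ γ '' [0, s]` with `s < t`, lightness gives `u ∈ (s, t]` with `γ u ≠ γ s`; near `u`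
the curve stays at distance `> d/2` from `γ s` (`d = |γ u - γ s|`), lightness again gives a
sub-stretch of positive displacement there, and every point of it is a past point (`≤ s`) far from
`γ s` — an `(η, ρ)`-shadowing with `η, ρ ≥ 1/(k+1)` for some `k`.
(vendored from the crux workfile `Cruxes/SimpleSubseqLimits/Lines/past-shadowing-costs-halves.lean`,
planner-cruxplan-stmt-CriticalPhenomena-4982-past-shadowing-costs-0; argmax lemma by crux ideator 3)
[folklore] -/
theorem strictGrowth_of_not_shadows (γ : Curve ℂ)
    (hlight : ∀ s t : I, s < t → ∃ u, s ≤ u ∧ u ≤ t ∧ γ u ≠ γ s)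
    (hns : ∀ k : ℕ, ¬ Shadows γ (1 / ((k : ℝ) + 1)) (1 / ((k : ℝ) + 1))) :
    ∀ s t : I, s < t → ¬ (γ '' Set.Icc s t ⊆ γ '' Set.Icc 0 s) := by
  intro s t hst hsub
  obtain ⟨u, hsu, hut, hne⟩ := hlight s t hst
  have hsu' : s < u := lt_of_le_of_ne hsu (fun h => hne (congrArg γ h).symm)
  set d : ℝ := dist (γ u) (γ s) with hd
  have hdpos : 0 < d := dist_pos.2 hne
  -- near `u` the curve stays far from `γ s`
  have hcont : ContinuousAt (fun x : I => dist (γ x) (γ s)) u :=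
    (γ.continuous.dist continuous_const).continuousAt
  obtain ⟨τ, hτ, hτd⟩ : ∃ τ > 0, ∀ x : I, dist x u < τ → d / 2 < dist (γ x) (γ s) := by
    have hlt : d / 2 < dist (γ u) (γ s) := by rw [← hd]; linarith
    have hev : ∀ᶠ x in 𝓝 u, d / 2 < dist (γ x) (γ s) := hcont.eventually (lt_mem_nhds hlt)
    obtain ⟨τ, hτ, hball⟩ := Metric.eventually_nhds_iff.1 hev
    exact ⟨τ, hτ, fun x hx => hball hx⟩
  -- the left end `u₁ = max s (u - τ/2)` of a short parameter interval ending at `u`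
  have hsuR : (s : ℝ) < (u : ℝ) := Subtype.coe_lt_coe.2 hsu'
  have hu1mem : max (s : ℝ) ((u : ℝ) - τ / 2) ∈ Set.Icc (0 : ℝ) 1 :=
    ⟨le_max_of_le_left s.2.1, max_le s.2.2 (by linarith [u.2.2])⟩
  set u₁ : I := ⟨max (s : ℝ) ((u : ℝ) - τ / 2), hu1mem⟩ with hu₁
  have hsu1 : s ≤ u₁ := Subtype.coe_le_coe.1 (le_max_left _ _)
  have hu1u : u₁ < u := Subtype.coe_lt_coe.1 (max_lt hsuR (by linarith))
  have hclose : ∀ x : I, u₁ ≤ x → x ≤ u → dist x u < τ := by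
    intro x hx1 hx2
    have h1 : (u : ℝ) - τ / 2 ≤ (x : ℝ) := (le_max_right _ _).trans (Subtype.coe_le_coe.2 hx1)
    have h2 : (x : ℝ) ≤ (u : ℝ) := Subtype.coe_le_coe.2 hx2
    rw [Subtype.dist_eq, Real.dist_eq, abs_sub_lt_iff]
    constructor <;> linarith
  -- lightness on `[u₁, u]`: a sub-stretch of positive displacement
  obtain ⟨w, hu1w, hwu, hwne⟩ := hlight u₁ u hu1u
  have hη₀ : 0 < dist (γ u₁) (γ w) := dist_pos.2 (Ne.symm hwne)
  obtain ⟨k, hk⟩ := exists_nat_one_div_lt (lt_min hη₀ (half_pos hdpos))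
  apply hns k
  refine ⟨s, u₁, w, hsu1, hu1w, (hk.trans_le (min_le_left _ _)).le, ?_⟩
  intro x hx1 hx2
  have hxI : x ∈ Set.Icc s t := ⟨hsu1.trans hx1, hx2.trans (hwu.trans hut)⟩
  obtain ⟨y, hy, hyx⟩ := hsub ⟨x, hxI, rfl⟩
  refine ⟨y, ⟨hy.2, ?_⟩, hyx⟩
  have hfar : d / 2 < dist (γ x) (γ s) := hτd x (hclose x hx1 (hx2.trans hwu))
  rw [hyx]
  exact ((hk.trans_le (min_le_right _ _)).trans hfar).le

/-! ## SHAPE + ORDER ⇒ simple -/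

/-- **SHAPE + ORDER ⇒ simple, for one class**: a class whose range is a simple arc with the same
endpoints and none of whose representatives `(1/(k+1), 1/(k+1))`-shadows its past (all `k`) is
simple — light representative (`Curve.exists_light_of_ne`, the class is non-constant because
`e 0 ≠ e 1`), strict growth (`strictGrowth_of_not_shadows`), argmax lemma.
(vendored from the crux workfile `Cruxes/SimpleSubseqLimits/Lines/past-shadowing-costs-halves.lean`,
planner-cruxplan-stmt-CriticalPhenomena-4982-past-shadowing-costs-0; argmax lemma by crux ideator 3)
[folklore] -/
theorem mem_simple_of_arc_of_notMem_shadowEvent (c : CurveClass ℂ) (e : C(I, ℂ))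
    (he : Injective e) (hrange : range e = c.range) (h0 : e 0 = c.source) (h1 : e 1 = c.target)
    (hns : ∀ k : ℕ, c ∉ shadowEvent (1 / ((k : ℝ) + 1)) (1 / ((k : ℝ) + 1))) :
    c ∈ CurveClass.simple := by
  obtain ⟨γ₀, rfl⟩ := CurveClass.surjective_mk c
  have h01 : γ₀ 0 ≠ γ₀ 1 := by
    intro h
    have he01 : e 0 = e 1 := by
      rw [h0, h1, CurveClass.source_mk, CurveClass.target_mk, Curve.source_def, Curve.target_def]
      exact h
    have h01' : ((0 : I) : ℝ) = ((1 : I) : ℝ) := congrArg Subtype.val (he he01)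
    norm_num at h01'
  obtain ⟨γ, hγc, hγ0, hγ1, hlight, -⟩ := Curve.exists_light_of_ne h01
  have hnsγ : ∀ k : ℕ, ¬ Shadows γ (1 / ((k : ℝ) + 1)) (1 / ((k : ℝ) + 1)) :=
    fun k hk => hns k ⟨γ, hγc, hk⟩
  have hgrow := strictGrowth_of_not_shadows γ hlight hnsγ
  rw [← hγc]
  refine simple_of_arc_range_of_strictGrowth γ e he ?_ ?_ ?_ hgrow
  · rw [hrange, ← hγc, CurveClass.range_mk]
  · rw [h0, CurveClass.source_mk, Curve.source_def, hγ0]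
  · rw [h1, CurveClass.target_mk, Curve.target_def, hγ1]

/-! ## The registered stub -/

/-- **Stub `stub_shadowGlue` of the line `marked-point-revisit` — SHAPE + ORDER ⇒ simple, one
class at a time**: a class whose range is a simple arc with the same endpoints and which lies in no
shadow event `(1/(k+1), 1/(k+1))` is simple (`mem_simple_of_arc_of_notMem_shadowEvent`: light
representative, strict range growth, argmax lemma). [folklore] -/
theorem stub_shadowGlue :
    ∀ (c : CurveClass ℂ) (e : C(I, ℂ)), Injective e → range e = c.range → e 0 = c.source →
      e 1 = c.target → (∀ k : ℕ, c ∉ shadowEvent (1 / ((k : ℝ) + 1)) (1 / ((k : ℝ) + 1))) →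
        c ∈ CurveClass.simple :=
  fun c e he hr h0 h1 hns => mem_simple_of_arc_of_notMem_shadowEvent c e he hr h0 h1 hns

end Summit.CriticalPhenomena.SAWScalingLimit.Theorems.SimpleSubseqLimits.MarkedPointRevisit.ShadowGlue

end
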